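import Summits.QuantumFields.YangMills.Theorems.UnitScaleTiltProp7QprimeCombL2Onto
import Literature.MathematicalPhysics.QuantumFieldTheory.Balaban1983to89.B9B8AveragingKernelZd
import Literature.MathematicalPhysics.QuantumFieldTheory.Balaban1983to89.B9Eq319BumpSectionLaplacianBackground
import HarnessLib

/-!
# Route `UnitScaleTilt`, crux K1 «MinimiserStabilityRegPr» (stmt-QuantumFields-19200) — route-R E′ (A′), LANE II «DIVERGENCE RECOVERY AT CURVED `W`» (★★OWNER RULING №23),
# brick (B2a), FILE F2: **BUMP SECTIONS OF THE PRINT-LITERAL COMB SITE AVERAGING `QprimeCombL2 W`** — for ANY periodic frame field `σ` on `ℤ³` and ANY periodic real profile `β`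
# normalised to `Σ_{box} β = ℓ³`, the section `u ↦ (x ↦ β(x)·Ad(σ(x))⁻¹ u(y(x)))` (descended to the member's torus) is averaged by `Q′_W` FIBREWISE:
# `Q′_W(J⁰u)(y) = M_y(u(y))`, `M_y m = Σ_{x ∈ box y} ℓ⁻³β(x)·Ad(τ_W(y,x)·σ(x)⁻¹)m`, `τ_W` the HIERARCHICAL transporter of ✓`QprimeCombL2_apply` (lit `compT`); hence
# (i) at `σ := τ_W` it is an EXACT right inverse for EVERY background (the smooth generalisation of ✓`QprimeCombL2_surjective`'s corner spread), and (ii) for a general frame, once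
# `‖M_y m − m‖ ≤ θ‖m‖` with `θ < 1`, a FIBREWISE correction `N_y = M_y⁻¹` makes `J⁰∘N` exact and, with ANY quasi-interpolant `I`, `J := I + J⁰∘N∘(1 − Q′_W∘I)` exact
# (★p1 g19 SIGNATURE-0 (B2a) construction, step «exactness»; the frame `σ` = one-shot axial gauge and the bound on `θ` = the ONE fat-loop comparison are the sequel files F3∕F2b).

Cell `ym3-torus` ∕ fleet seat `ym-ust-19200-p1` (gen 19, route-R E′ namer, LANE II namer; (B2a) pen).  THEOREMS ONLY (0 `def`, 0 `sorry`); `--supports stmt-QuantumFields-19200 --as helper`,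
count-neutral.  YM₃ on T³ is a ladder rung (R3), not d = 4, not the Clay problem; nothing here claims [Balaban1985BackgroundPropagators] Thm 3.11, `hN06`, (REC), E′, EX or the gap.

THE PRINT.  [Balaban1985BackgroundPropagators] (3.19) p. 393 «(Q′(V)λ)(y) = Σ_{x∈B(y)} L^{−d}R(V(Γ_{y,x}))λ(x) … Q′_j(U) = Q′(Ūʲ⁻¹)·…·Q′(U)» — in the tree ✓`QprimeCombL2_apply` ∘ lit
✓`B9B8AveragingKernelZd.QprimeIter_zd_eq_sum_blockIter`: ONE kernel on the `Lᵏ`-box with the composite transporter `compT`.  A right inverse of `Q′` is NOT print's device (print uses «Q′ onto»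
and `(Q′G′²Q′*)⁻¹`); bump sections are the cell's ∕ pub-balaban NE9's device (lit ✓`B9Eq319BumpSection`, one step, small field) — here at `k` levels, any background, any frame.

WHAT IS PROVED (ns `…Theorems.Prop7QprimeCombBumpSection`; member `F`, `n ≤ K`, `k := K − n`, `ℓ := Lᵏ`, weight `c₀`; `W♯ := pull (bgUnits F K W) (basePt F n K)`, `N₀ = (F.P K).sitesPerDir 0`,
`N_k = (F.P K).sitesPerDir k`, `τ_W(y, x) := compT L (bgT L W♯) k y x`):
* §1 `iterate_blockMap_add_period` (`⌊·∕L⌋^[k]` sends `x + N₀•m` to `⌊x⌋ + N_k•m`), `isPeriodic_sectionFun` (the section's `ℤ³` function is `N₀`-periodic when `σ`, `β` are).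
* §2 ★★★ `exists_bumpSection` — for periodic `σ : ℤ³ → (M₂)ˣ`, `β : ℤ³ → ℝ`: a ℂ-LINEAR `J⁰ : (Site (F.P K) k → M₂) →ₗ[ℂ] SiteL2K` with the POINTWISE row
  `toL2S⁻¹(J⁰u)(transl x₀ z) = β z • Ad(σ z)⁻¹ (u (tcls N_k (⌊z⌋^[k])))` and the AVERAGING IDENTITY `Q′_W(J⁰u)(y) = Σ_{x ∈ blockIter L k (tlift y)} ((L³)⁻¹)ᵏβ(x) • Ad(τ_W(tlift y, x)·(σ x)⁻¹)(u y)`.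
* §3 ★★ `exists_exact_bumpSection_compT` — at the hierarchical frame `σ := x ↦ τ_W(⌊x⌋^[k], x)` (periodic by (3.19)'s translation covariance, DISPLAYED as a row `hτ`) and `Σ_{box}((L³)⁻¹)ᵏβ = 1`:
  `Q′_W(J⁰u) = u` EXACTLY, every `W` — the smooth-profile generalisation of ✓`QprimeCombL2_surjective`.
* §4 ★★★ `exists_exact_of_fibrewise_near_id` — GENERIC EXACTNESS BY FIBREWISE CORRECTION: `Q′ : S →ₗ C`, `C = (ι → V)`, `J⁰ I : C →ₗ S`, `Q′(J⁰u) y = M_y(u y)` with `‖M_y m − m‖ ≤ θ‖m‖`,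
  `θ < 1` ⊢ `∃ N : C →ₗ C` fibrewise (`(N u) y = N_y (u y)`, `M_y ∘ N_y = id`, `‖N_y m‖ ≤ (1−θ)⁻¹‖m‖`) and `J := I + J⁰∘N∘(1 − Q′∘I)` with `Q′∘J = id` — over lit
  ✓`B9Eq319BumpSectionLaplacianBackground.exists_inverse_of_norm_sub_le`.
HONEST SCOPE.  Lattice bookkeeping + finite-dimensional linear algebra; no estimate (the `θ`-bound = F3's fat-loop comparison; the gradient∕size rows = F2b); nothing of print asserted; rung R3,
not Clay; YM gap NOT proved.

References: T. Bałaban, CMP 99 (1985) 389–434 [Balaban1985BackgroundPropagators] ((3.17)–(3.19) p.393, Thm 3.11 p.416); CMP 98 (1985) 17–51 [Balaban1985Averaging] ((52)–(53) p.27, (78)–(80) p.30);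
CMP 99 (1985) 75–102 [Balaban1985RegularSpaces] (p.77).
-/

set_option autoImplicit false

noncomputable section

open scoped Matrix.Norms.L2Operator BigOperators

namespace Summit.QuantumFields.YangMills.Theorems.Prop7QprimeCombBumpSection

open Literature.MathematicalPhysics.QuantumFieldTheory.Balaban1983to89
open Literature.MathematicalPhysics.QuantumFieldTheory.Balaban1983to89.T3ContinuumYM3Torus
open Literature.MathematicalPhysics.QuantumLattice (blockMap blockBase blockSites mem_blockSites_iff)
open B7Prop1Explicit renaming Site → LSite
open B7Eq78Linearization (conjR conjR_apply conjR_smul_real QprimeIter zdBlocking)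
open B7Prop3GeneralRotated (conjR_mul_left)
open B8Ineq132 (conjR_conjR)
open B8Eq119TwistedAxial (bgT)
open B9B8AveragingKernelZd (blockIter mem_blockIter_iff compT QprimeIter_zd_eq_sum_blockIter)
open B10Eq27TorusAxialLog (transl pull)
open T4TermwiseTorus (IsPeriodic tcls tlift tcls_tlift tcls_add tcls_period)
open T3SectALandauChart (bgUnits)
open B11Eq103H1Complex (SiteL2K)
open Summit.QuantumFields.YangMills.Theorems.Prop7SectET3Transport (periodsT3)
open Summit.QuantumFields.YangMills.Theorems.Prop7SectET3HilbertLetters (W₂ toL2S)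
open Summit.QuantumFields.YangMills.Theorems.Prop7SPrint (basePt)
open Summit.QuantumFields.YangMills.Theorems.Prop7QprimeCombL2 (QprimeCombL2 QprimeCombL2_apply sitesPerDir_zero_eq comp_transl_descend)

/-! ## §1 Periodicity bookkeeping on `ℤ³` -/

section Periodic

variable {d : ℕ}

/-- `⌊·∕L⌋` iterated `k` times sends `x + (LᵏP)•m` to `⌊x⌋^[k] + P•m`. [folklore; cite: Balaban1985RegularSpaces, p.77 («every block lattice divides T_η»)] -/
theorem iterate_blockMap_add_period (L : ℕ) [NeZero L] : ∀ (k P : ℕ) (x m : LSite d),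
    (blockMap L)^[k] (x + ((L ^ k * P : ℕ) : ℤ) • m) = (blockMap L)^[k] x + ((P : ℕ) : ℤ) • m
  | 0, P, x, m => by simp
  | k + 1, P, x, m => by
      have hL : (L : ℤ) ≠ 0 := by exact_mod_cast NeZero.ne L
      rw [Function.iterate_succ_apply, Function.iterate_succ_apply]
      have h1 : blockMap L (x + ((L ^ (k + 1) * P : ℕ) : ℤ) • m) = blockMap L x + ((L ^ k * P : ℕ) : ℤ) • m := by
        funext i
        simp only [blockMap, Pi.add_apply, Pi.smul_apply, smul_eq_mul, Nat.cast_pow, Nat.cast_mul]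
        rw [show (L : ℤ) ^ (k + 1) * (P : ℤ) * m i = (L : ℤ) ^ k * (P : ℤ) * m i * (L : ℤ) by ring, Int.add_mul_ediv_right _ _ hL]
      rw [h1, iterate_blockMap_add_period L k P (blockMap L x) m]

/-- On the box of `y`, the `k`-th ancestor is `y`. [cite: Balaban1985Averaging, (52)–(53) p.27] -/
theorem iterate_blockMap_of_mem_blockIter (L : ℕ) [NeZero L] {k : ℕ} {y x : LSite d} (hx : x ∈ blockIter L k y) : (blockMap L)^[k] x = y :=
  (mem_blockIter_iff L k y x).1 hx

end Periodic

/-! ## §2 The bump section and its averaging identity -/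

section Member

variable (F : T3Family) (n K : ℕ) (c₀ : ℝ)

/-- ★★★ **THE BUMP SECTION OF `QprimeCombL2 W` AND ITS FIBREWISE AVERAGING IDENTITY.**  For a frame field `σ : ℤ³ → (M₂)ˣ` and a real profile `β : ℤ³ → ℝ`, both `N₀`-periodic
(`N₀ = (F.P K).sitesPerDir 0`, the period of the based pullback), there is a ℂ-linear `J⁰` from coarse functions to gauge parameters with
(POINTWISE) `toL2S⁻¹(J⁰u)(transl x₀ z) = β(z) • Ad(σ z)⁻¹ (u (tcls N_k (⌊z⌋^[k])))`, `x₀ = basePt F n K`, `k = K − n`, and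
(AVERAGING) `Q′_W(J⁰u)(y) = Σ_{x ∈ blockIter L k (tlift y)} ((L³)⁻¹)ᵏ·β(x) • Ad(τ_W(tlift y, x)·(σ x)⁻¹)(u y)`, `τ_W = compT L (bgT L W♯) k` — the value at `y` depends on `u y` ALONE.
[cite: Balaban1985BackgroundPropagators, (3.17)-(3.19) p.393; Balaban1985Averaging, (52)-(53) p.27, (78) p.30] -/
theorem exists_bumpSection (hnK : n ≤ K) (W : GaugeField (F.P K) 0 (Matrix.specialUnitaryGroup (Fin 2) ℂ))
    (σ : LSite (F.P K).d → (Matrix (Fin 2) (Fin 2) ℂ)ˣ) (β : LSite (F.P K).d → ℝ)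
    (hσ : IsPeriodic ((F.P K).sitesPerDir 0) σ) (hβ : IsPeriodic ((F.P K).sitesPerDir 0) β) :
    ∃ J₀ : (Site (F.P K) (K - n) → Matrix (Fin 2) (Fin 2) ℂ) →ₗ[ℂ] SiteL2K ℂ 3 (periodsT3 F K) c₀ W₂,
      (∀ (u : Site (F.P K) (K - n) → Matrix (Fin 2) (Fin 2) ℂ) (z : LSite (F.P K).d),
        (toL2S F K c₀).symm (J₀ u) (transl (basePt F n K) z)
          = β z • conjR (σ z)⁻¹ (u (tcls ((F.P K).sitesPerDir (K - n)) ((blockMap (F.P K).L)^[K - n] z)))) ∧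
      (∀ (u : Site (F.P K) (K - n) → Matrix (Fin 2) (Fin 2) ℂ) (y : Site (F.P K) (K - n)),
        QprimeCombL2 F n K c₀ W (J₀ u) y
          = ∑ x ∈ blockIter (F.P K).L (K - n) (tlift y),
              (((((F.P K).L : ℝ) ^ (F.P K).d)⁻¹) ^ (K - n) * β x) •
                conjR (compT (F.P K).L (bgT (F.P K).L (pull (bgUnits F K W) (basePt F n K))) (K - n) (tlift y) x * (σ x)⁻¹) (u y)) := by
  haveI : NeZero (F.P K).L := ⟨by have h := F.hL.2; show F.L ≠ 0; omega⟩
  -- the section's `ℤ³` function and its periodicity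
  set Nk : ℕ := (F.P K).sitesPerDir (K - n) with hNk
  set G : (Site (F.P K) (K - n) → Matrix (Fin 2) (Fin 2) ℂ) → LSite (F.P K).d → Matrix (Fin 2) (Fin 2) ℂ :=
    fun u z => β z • conjR (σ z)⁻¹ (u (tcls Nk ((blockMap (F.P K).L)^[K - n] z))) with hG
  have hper : ∀ u, IsPeriodic ((F.P K).sitesPerDir 0) (G u) := by
    intro u z m
    simp only [hG]
    rw [hβ z m, hσ z m, sitesPerDir_zero_eq F n K hnK, iterate_blockMap_add_period, tcls_add, tcls_period, add_zero]
  -- the descended torus function, linear in `u`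
  let Λ : (Site (F.P K) (K - n) → Matrix (Fin 2) (Fin 2) ℂ) →ₗ[ℂ] (Site (F.P K) 0 → Matrix (Fin 2) (Fin 2) ℂ) :=
    { toFun := fun u x => G u (tlift (fun κ => x κ - basePt F n K κ))
      map_add' := fun u v => by
        funext x; simp only [hG, Pi.add_apply]
        rw [show conjR (σ _)⁻¹ (u _ + v _) = conjR (σ _)⁻¹ (u _) + conjR (σ _)⁻¹ (v _) from B7Eq78Linearization.conjR_add _ _ _, smul_add]
      map_smul' := fun c u => by
        funext x; simp only [hG, Pi.smul_apply, RingHom.id_apply]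
        rw [show conjR (σ _)⁻¹ (c • u _) = c • conjR (σ _)⁻¹ (u _) by rw [conjR_apply, conjR_apply, Matrix.mul_smul, Matrix.smul_mul], smul_comm] }
  refine ⟨(toL2S F K c₀).toLinearMap ∘ₗ Λ, fun u z => ?_, fun u y => ?_⟩
  · -- pointwise row
    rw [LinearMap.comp_apply, LinearEquiv.coe_toLinearMap, LinearEquiv.symm_apply_apply]
    show G u (tlift (fun κ => transl (basePt F n K) z κ - basePt F n K κ)) = _
    exact comp_transl_descend (basePt F n K) (hper u) z
  · -- averaging identity
    rw [QprimeCombL2_apply, LinearMap.comp_apply, LinearEquiv.coe_toLinearMap, LinearEquiv.symm_apply_apply]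
    have hread : (fun z => Λ u (transl (basePt F n K) z)) = G u := funext fun z => comp_transl_descend (basePt F n K) (hper u) z
    rw [hread, QprimeIter_zd_eq_sum_blockIter]
    refine Finset.sum_congr rfl fun x hx => ?_
    have hanc : (blockMap (F.P K).L)^[K - n] x = tlift y := iterate_blockMap_of_mem_blockIter (F.P K).L hx
    simp only [hG]
    rw [hanc, tcls_tlift, conjR_smul_real, smul_smul, conjR_conjR]

/-! ## §3 The exact section at the hierarchical frame -/

/-- ★★ **AT THE HIERARCHICAL FRAME THE BUMP SECTION IS EXACT FOR EVERY BACKGROUND.**  If the frame field is the composite transporter itself, `σ x = τ_W(⌊x⌋^[k], x)` (its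
`N₀`-periodicity displayed as the row `hσ`), and the profile is normalised per box, `Σ_{x ∈ blockIter L k y}((L³)⁻¹)ᵏβ x = 1`, then `Q′_W(J⁰u) = u`: the smooth-profile generalisation
of ✓`QprimeCombL2_surjective` (which is the case «`β` = `ℓ³` at the corner, `0` elsewhere»).  [cite: Balaban1985BackgroundPropagators, (3.19) p.393, Thm 3.11 p.416 («Q′ onto»)] -/
theorem exists_exact_bumpSection_compT (hnK : n ≤ K) (W : GaugeField (F.P K) 0 (Matrix.specialUnitaryGroup (Fin 2) ℂ)) (β : LSite (F.P K).d → ℝ)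
    (hβ : IsPeriodic ((F.P K).sitesPerDir 0) β)
    (hβ1 : ∀ y : LSite (F.P K).d, ∑ x ∈ blockIter (F.P K).L (K - n) y, (((((F.P K).L : ℝ) ^ (F.P K).d)⁻¹) ^ (K - n) * β x) = 1)
    (hσ : IsPeriodic ((F.P K).sitesPerDir 0)
      (fun x => compT (F.P K).L (bgT (F.P K).L (pull (bgUnits F K W) (basePt F n K))) (K - n) ((blockMap (F.P K).L)^[K - n] x) x)) :
    ∃ J₀ : (Site (F.P K) (K - n) → Matrix (Fin 2) (Fin 2) ℂ) →ₗ[ℂ] SiteL2K ℂ 3 (periodsT3 F K) c₀ W₂,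
      (∀ (u : Site (F.P K) (K - n) → Matrix (Fin 2) (Fin 2) ℂ) (z : LSite (F.P K).d),
        (toL2S F K c₀).symm (J₀ u) (transl (basePt F n K) z)
          = β z • conjR (compT (F.P K).L (bgT (F.P K).L (pull (bgUnits F K W) (basePt F n K))) (K - n) ((blockMap (F.P K).L)^[K - n] z) z)⁻¹
              (u (tcls ((F.P K).sitesPerDir (K - n)) ((blockMap (F.P K).L)^[K - n] z)))) ∧
      ∀ u : Site (F.P K) (K - n) → Matrix (Fin 2) (Fin 2) ℂ, QprimeCombL2 F n K c₀ W (J₀ u) = u := by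
  haveI : NeZero (F.P K).L := ⟨by have h := F.hL.2; show F.L ≠ 0; omega⟩
  obtain ⟨J₀, hpt, havg⟩ := exists_bumpSection F n K c₀ hnK W _ β hσ hβ
  refine ⟨J₀, hpt, fun u => funext fun y => ?_⟩
  rw [havg]
  have hterm : ∀ x ∈ blockIter (F.P K).L (K - n) (tlift y),
      (((((F.P K).L : ℝ) ^ (F.P K).d)⁻¹) ^ (K - n) * β x) •
        conjR (compT (F.P K).L (bgT (F.P K).L (pull (bgUnits F K W) (basePt F n K))) (K - n) (tlift y) x *
          (compT (F.P K).L (bgT (F.P K).L (pull (bgUnits F K W) (basePt F n K))) (K - n) ((blockMap (F.P K).L)^[K - n] x) x)⁻¹) (u y)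
      = (((((F.P K).L : ℝ) ^ (F.P K).d)⁻¹) ^ (K - n) * β x) • u y := by
    intro x hx
    rw [iterate_blockMap_of_mem_blockIter (F.P K).L hx, mul_inv_cancel, conjR_apply, Units.val_one, inv_one, Units.val_one, one_mul, mul_one]
  rw [Finset.sum_congr rfl hterm, ← Finset.sum_smul, hβ1, one_smul]

end Member

/-! ## §4 Exactness by a fibrewise correction (generic) -/

section Fibrewise

variable {S : Type*} [AddCommGroup S] [Module ℂ S]
variable {ι : Type*} {V : Type*} [NormedAddCommGroup V] [NormedSpace ℂ V] [FiniteDimensional ℂ V]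

/-- ★★★ **EXACTNESS BY A FIBREWISE CORRECTION.**  Coarse functions `C = ι → V` (`V` finite-dimensional), `Q′ : S →ₗ C`, a section candidate `J⁰ : C →ₗ S` averaged FIBREWISE —
`Q′(J⁰u) y = M_y (u y)` with `‖M_y m − m‖ ≤ θ‖m‖`, `θ < 1` — and ANY `I : C →ₗ S`.  Then there is a fibrewise `N : C →ₗ C` (`(N u) y = N_y (u y)`, `M_y (N_y m) = m`,
`‖N_y m‖ ≤ (1 − θ)⁻¹‖m‖`) such that `J := I + J⁰ ∘ N ∘ (1 − Q′ ∘ I)` is an EXACT right inverse: `Q′ (J w) = w`.  (lit ✓`exists_inverse_of_norm_sub_le` fibre by fibre.)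
[folklore; cite: Balaban1985BackgroundPropagators, (3.19) p.393] -/
theorem exists_exact_of_fibrewise_near_id (Q' : S →ₗ[ℂ] (ι → V)) (J₀ I : (ι → V) →ₗ[ℂ] S)
    (M : ι → V →ₗ[ℂ] V) (hM : ∀ (u : ι → V) (y : ι), Q' (J₀ u) y = M y (u y))
    {θ : ℝ} (hθ : θ < 1) (hθM : ∀ (y : ι) (m : V), ‖M y m - m‖ ≤ θ * ‖m‖) :
    ∃ N : (ι → V) →ₗ[ℂ] (ι → V),
      (∃ Ny : ι → V →ₗ[ℂ] V, (∀ u y, N u y = Ny y (u y)) ∧ (∀ y m, M y (Ny y m) = m) ∧ (∀ y m, ‖Ny y m‖ ≤ (1 - θ)⁻¹ * ‖m‖)) ∧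
      ∀ w : ι → V, Q' ((I + J₀ ∘ₗ N ∘ₗ (LinearMap.id - Q' ∘ₗ I) : (ι → V) →ₗ[ℂ] S) w) = w := by
  -- fibrewise inverses
  have hfib : ∀ y : ι, ∃ Ny : V →ₗ[ℂ] V, (∀ m, M y (Ny m) = m) ∧ (∀ m, Ny (M y m) = m) ∧ ∀ m, ‖Ny m‖ ≤ (1 - θ)⁻¹ * ‖m‖ :=
    fun y => B9Eq319BumpSectionLaplacianBackground.exists_inverse_of_norm_sub_le (M y) hθ (hθM y)
  choose Ny hNy1 hNy2 hNy3 using hfib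
  let N : (ι → V) →ₗ[ℂ] (ι → V) :=
    { toFun := fun u y => Ny y (u y)
      map_add' := fun u v => by funext y; simp only [Pi.add_apply, map_add]
      map_smul' := fun c u => by funext y; simp only [Pi.smul_apply, map_smul, RingHom.id_apply] }
  refine ⟨N, ⟨Ny, fun u y => rfl, hNy1, hNy3⟩, fun w => ?_⟩
  funext y
  rw [LinearMap.add_apply, map_add, Pi.add_apply, LinearMap.comp_apply, LinearMap.comp_apply, hM]
  show Q' (I w) y + M y (Ny y (((LinearMap.id - Q' ∘ₗ I : (ι → V) →ₗ[ℂ] (ι → V)) w) y)) = w y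
  rw [hNy1, LinearMap.sub_apply, LinearMap.id_apply, LinearMap.comp_apply, Pi.sub_apply, add_sub_cancel]

end Fibrewise

end Summit.QuantumFields.YangMills.Theorems.Prop7QprimeCombBumpSection

end
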